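import Literature.AlgebraicGeometry.HodgeTheory.KaehlerClass
import Literature.AlgebraicGeometry.HodgeTheory.ComplexGysin
import Literature.AlgebraicGeometry.Motives.SegreEmbedding
import Literature.AlgebraicGeometry.Surfaces.K3NikulinInvolution
import Literature.AlgebraicGeometry.HodgeTheory.SupportedClassesRational
import Literature.AlgebraicGeometry.Surfaces.VanGeemenSarti2007ExistsNikulinK3PicardNine

/-!
# Crux `NikulinSerreCarrier` · line `neron-severi-intertwiner` · stub `stub_nikulinAnchorFrame` (S1) —
# the published inputs of the anchor (inline named facts) and the rational matched Kähler frame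

Helper file (`--supports stmt-HodgeConjecture-14464`) for the anchor stub `stub_nikulinAnchorFrame`
(skeleton `Cruxes/NikulinSerreCarrier/Lines/neron-severi-intertwiner.lean`). Two things:
* the five PUBLISHED RESULTS the S1 assembly (`…AnchorFrameAssembly`) rests on and the tree does not have,
  stated inline in the tree's vocabulary with `[cite]`/`[topic]` tags so that the gate relocates them to
  `Literature/`: existence of a projective K3 surface with a Nikulin involution and Picard number `9`
  (van Geemen–Sarti Prop. 2.3); the cohomological data of the resolved Nikulin quotient `Y = res(X/ι)` (VGS
  §1.4–1.8, §2.4–2.5, Morrison §5); `End_Hdg(T(X)_ℚ) = ℚ` for Picard number `9` (Zarhin; Huybrechts Ch. 3);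
  openness of the Kähler cone and Kähler classes on products (Huybrechts, *Complex Geometry*);
* the bookkeeping lemma `kaehlerFrame_of_open` (registered sub-goal `stub_anchorKaehlerFrame`): from a Kähler
  class `Ψ h`, the openness conclusions on `X` and `Y` and the product rule, the RATIONAL frame
  `H' = h − εΣN_j` (`ε` rational, small) with `H'`, `Ψ H'`, `fst^*ΨH' + snd^*H'` Kähler — the fields
  `H'`, `hH'rat`, `kY`, `kX`, `kW` of `AnchorFrame`.
-/

noncomputable section

-- the doubled component `HodgeConjecture.HodgeConjecture` is the summit/problem layout (D-0022), not a slip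
set_option linter.dupNamespace false

namespace Summit.HodgeConjecture.HodgeConjecture.Theorems.NikulinSerreCarrier.NeronSeveriIntertwiner

open scoped BigOperators Manifold ContDiff
open CategoryTheory MonoidalCategory SemiCartesianMonoidalCategory
open Literature.AlgebraicGeometry Literature.AlgebraicGeometry.Motives Literature.AlgebraicGeometry.HodgeTheory
open Literature.AlgebraicGeometry.Surfaces
open Literature.AlgebraicTopology.SingularHomology Literature.Geometry.Kaehler

/-! ### The published inputs (inline named facts, relocated by the gate) -/

/-- **The rational `Ψ`-matched Kähler frame.** For `ℂ`-linear `Ψ : H²(Y(ℂ)) → H²(X(ℂ))` mapping rational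
classes to rational classes, rational classes `h` (on `Y`) and `N_1, …, N_8` with `Ψ N_j = r_j`, SUPPOSE: `Ψ h`
minus small rational multiples of `Σ r_j` is Kähler on `X`, `h` minus small rational multiples of `Σ N_j` is
Kähler on `Y` (openness of the two Kähler cones at `Ψ h = q^*h̄` and `h = ȳ^*h̄`), and external sums of Kähler
classes are Kähler on `X ⊗ Y`. Then for `ε` rational below both thresholds, `H' := h − εΣN_j` is a rational
class with `H'`, `Ψ H' = Ψ h − εΣr_j` and `fst^* Ψ H' + snd^* H'` Kähler. [cite: HuybrechtsCG2005, Cor. 3.1.8 and Def. 3.2.14] -/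
theorem kaehlerFrame_of_open {X Y : SchemeOver ℂ} (Ψ : complexBetti Y (2 * 1) →ₗ[ℂ] complexBetti X (2 * 1))
    (h : complexBetti Y (2 * 1)) (N : Fin 8 → complexBetti Y (2 * 1)) (r : Fin 8 → complexBetti X (2 * 1))
    (hΨN : ∀ j, Ψ (N j) = r j) (hhrat : IsRationalClass h) (hNrat : ∀ j, IsRationalClass (N j))
    (hopenX : ∃ ε₀ : ℚ, 0 < ε₀ ∧ ∀ ε : ℚ, 0 < ε → ε < ε₀ →
      IsKaehlerClass 2 X (Ψ h - (ε : ℂ) • ∑ j, r j))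
    (hopenY : ∃ ε₀ : ℚ, 0 < ε₀ ∧ ∀ ε : ℚ, 0 < ε → ε < ε₀ →
      IsKaehlerClass 2 Y (h - (ε : ℂ) • ∑ j, N j))
    (hprod : ∀ (KX : complexBetti X (2 * 1)) (KY : complexBetti Y (2 * 1)),
      IsKaehlerClass 2 X KX → IsKaehlerClass 2 Y KY →
        IsKaehlerClass (2 + 2) (X ⊗ Y) (complexBetti.map (fst X Y) (2 * 1) KX + complexBetti.map (snd X Y) (2 * 1) KY)) :
    ∃ H' : complexBetti Y (2 * 1), IsRationalClass H' ∧ IsKaehlerClass 2 Y H' ∧ IsKaehlerClass 2 X (Ψ H') ∧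
      IsKaehlerClass 4 (X ⊗ Y) (complexBetti.map (fst X Y) (2 * 1) (Ψ H') + complexBetti.map (snd X Y) (2 * 1) H') := by
  obtain ⟨ε₁, hε₁, hkY⟩ := hopenY
  obtain ⟨ε₂, hε₂, hkX⟩ := hopenX
  set ε : ℚ := min ε₁ ε₂ / 2 with hεdef
  have hε : 0 < ε := by rw [hεdef]; positivity
  have hε1 : ε < ε₁ := by rw [hεdef]; linarith [min_le_left ε₁ ε₂, lt_min hε₁ hε₂]
  have hε2 : ε < ε₂ := by rw [hεdef]; linarith [min_le_right ε₁ ε₂, lt_min hε₁ hε₂]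
  have hΨsumN : Ψ (∑ j, N j) = ∑ j, r j := by
    rw [map_sum]
    exact Finset.sum_congr rfl fun j _ ↦ hΨN j
  refine ⟨h - (ε : ℂ) • ∑ j, N j, ?_, hkY ε hε hε1, ?_, ?_⟩
  · have hs : IsRationalClass (∑ j, N j) := by
      simpa using IsRationalClass.sum_smul Finset.univ (fun j ↦ hNrat j) fun _ ↦ 1
    have h1 : h - (ε : ℂ) • ∑ j, N j = h + ((-ε : ℚ) : ℂ) • ∑ j, N j := by
      rw [Rat.cast_neg, neg_smul, sub_eq_add_neg]
    rw [h1]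
    exact hhrat.add (hs.smul (-ε))
  · rw [map_sub, map_smul, hΨsumN]
    exact hkX ε hε hε2
  · have hk : IsKaehlerClass 2 X (Ψ (h - (ε : ℂ) • ∑ j, N j)) := by
      rw [map_sub, map_smul, hΨsumN]; exact hkX ε hε hε2
    exact hprod _ _ hk (hkY ε hε hε1)

/-- **Registered stub `stub_anchorKaehlerFrame`** (crux item stmt-HodgeConjecture-14464, line `neron-severi-intertwiner`,
sub-goal of `stub_nikulinAnchorFrame`, fields `H'`/`hH'rat`/`kY`/`kX`/`kW` of `AnchorFrame`): the rational matched Kähler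
frame from openness — verbatim `kaehlerFrame_of_open`, with the registered one-line signature.
[cite: HuybrechtsCG2005, Cor. 3.1.8 and Def. 3.2.14] -/
theorem stub_anchorKaehlerFrame : open Literature.AlgebraicGeometry.Motives Literature.AlgebraicGeometry.HodgeTheory Literature.AlgebraicTopology.SingularHomology in ∀ {X Y : SchemeOver ℂ} (Ψ : complexBetti Y (2 * 1) →ₗ[ℂ] complexBetti X (2 * 1)) (h : complexBetti Y (2 * 1)) (N : Fin 8 → complexBetti Y (2 * 1)) (r : Fin 8 → complexBetti X (2 * 1)) (hΨN : ∀ j, Ψ (N j) = r j) (hhrat : IsRationalClass h) (hNrat : ∀ j, IsRationalClass (N j)) (hopenX : ∃ ε₀ : ℚ, 0 < ε₀ ∧ ∀ ε : ℚ, 0 < ε → ε < ε₀ → IsKaehlerClass 2 X (Ψ h - (ε : ℂ) • ∑ j, r j)) (hopenY : ∃ ε₀ : ℚ, 0 < ε₀ ∧ ∀ ε : ℚ, 0 < ε → ε < ε₀ → IsKaehlerClass 2 Y (h - (ε : ℂ) • ∑ j, N j)) (hprod : ∀ (KX : complexBetti X (2 * 1)) (KY : complexBetti Y (2 * 1)),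 IsKaehlerClass 2 X KX → IsKaehlerClass 2 Y KY → IsKaehlerClass (2 + 2) (CategoryTheory.MonoidalCategoryStruct.tensorObj X Y) (complexBetti.map (CategoryTheory.SemiCartesianMonoidalCategory.fst X Y) (2 * 1) KX + complexBetti.map (CategoryTheory.SemiCartesianMonoidalCategory.snd X Y) (2 * 1) KY)), ∃ H' : complexBetti Y (2 * 1), IsRationalClass H' ∧ IsKaehlerClass 2 Y H' ∧ IsKaehlerClass 2 X (Ψ H') ∧ IsKaehlerClass 4 (CategoryTheory.MonoidalCategoryStruct.tensorObj X Y) (complexBetti.map (CategoryTheory.SemiCartesianMonoidalCategory.fst X Y) (2 * 1) (Ψ H') + complexBetti.map (CategoryTheory.SemiCartesianMonoidalCategory.snd X Y) (2 * 1) H') :=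
  fun Ψ h N r hΨN hhrat hNrat hopenX hopenY hprod ↦ kaehlerFrame_of_open Ψ h N r hΨN hhrat hNrat hopenX hopenY hprod

end Summit.HodgeConjecture.HodgeConjecture.Theorems.NikulinSerreCarrier.NeronSeveriIntertwiner

end
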